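import Literature.Combinatorics.Additive.EntropicRuzsaDistance
import Mathlib.Topology.Order.Compact
import HarnessLib

/-!
# PFR: existence of `τ`-minimisers and the first and second estimates (GGMT §2, §5, §6)

Topic `Literature/Combinatorics/Additive`. Everything in this file is PROVED.

* `EntropicRuzsa.isTauMin_exists` — GGMT §2 (proof of Theorem 1.8): `τ` is continuous on the
  compact `stdSimplex ℝ G × stdSimplex ℝ G`, so a minimising pair of laws `(μ₁, μ₂)` exists
  (`continuous_entFun/subLaw/dLaw/tauLaw`, `IsCompact.exists_isMinOn`).
* The setting of §§5–7 is kept abstract: four `G`-valued random variables `X₁, X₂, X₁', X₂'`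
  (GGMT: `X₁, X₂, X̃₁, X̃₂`) on one finite weighted set `(s, P)` with laws `μ₁, μ₂, μ₁, μ₂`, and
  the independence of the quadruple in the form of the three splittings
  `(X₁,X₂) ⊥ (X₁',X₂')`, `(X₁,X₂') ⊥ (X₂,X₁')`, `(X₁,X₁') ⊥ (X₂,X₂')` (hypotheses `iA iB iC`);
  `k = d[μ₁ ; μ₂]`, `U = X₁ + X₂`, `V = X₁' + X₂`, `W = X₁ + X₁'`, `S = X₁ + X₂ + X₁' + X₂'`,
  `I₁ = I[U : V | S]`, `I₂ = I[U : W | S]`.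
* `EntropicRuzsa.first_estimate` — GGMT (5.1): `I₁ ≤ 2 η k`; `EntropicRuzsa.ent_sum_four_le` —
  GGMT (5.10): `H[S] ≤ H[X₁]/2 + H[X₂]/2 + (2 + η) k - I₁` (both from `first_estimate_aux`:
  fibring identity Cor. 4.2 with `(X₁, X₂, X₂', X₁')`, minimality (3.9)/(3.10), Lemma 5.2 ×4).
* `EntropicRuzsa.second_estimate` — GGMT (6.1): `I₂ ≤ 2 η k + 2 η (2 η k - I₁)/(1 - η)`
  (fibring with `(X₁, X₂, X₁', X₂')`, converting `I[U : X₂ + X₂' | S]` into `I[U : W | S]`,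
  then (6.2)–(6.9)). Applied to `(X₁', X₂, X₁, X₂')` it also bounds `I₃ = I[V : W | S]`.

## References
* W. T. Gowers, B. Green, F. Manners, T. Tao, *On a conjecture of Marton*, Ann. of Math. (2)
  201 (2025), §2, §5, §6.
-/

open Finset Real Literature.Probability.Entropy.FiniteShannon

noncomputable section

namespace Literature.Combinatorics.Additive

namespace EntropicRuzsa

universe u

variable {G : Type u} [AddCommGroup G] [Fintype G]

/-! ### Existence of `τ`-minimisers (GGMT §2: compactness) -/

omit [AddCommGroup G] in
/-- The entropy functional is continuous on `G → ℝ`. [folklore] -/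
theorem continuous_entFun : Continuous (entFun : (G → ℝ) → ℝ) := by
  unfold entFun
  exact continuous_finsetSum _ fun x _ => continuous_negMulLog.comp (continuous_apply x)

/-- The difference law is (jointly) continuous in the two laws. [folklore] -/
theorem continuous_subLaw : Continuous (fun p : (G → ℝ) × (G → ℝ) => subLaw p.1 p.2) := by
  apply continuous_pi
  intro z
  unfold subLaw
  exact continuous_finsetSum _ fun y _ =>
    ((continuous_apply (z + y)).comp continuous_fst).mul ((continuous_apply y).comp continuous_snd)

/-- The Ruzsa distance of laws is (jointly) continuous. [cite: GowersEtAl2025, §2 (proof of Theorem 1.8)] -/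
theorem continuous_dLaw : Continuous (fun p : (G → ℝ) × (G → ℝ) => dLaw p.1 p.2) := by
  have h1 : Continuous (fun p : (G → ℝ) × (G → ℝ) => entFun (subLaw p.1 p.2)) :=
    continuous_entFun.comp continuous_subLaw
  have h2 : Continuous (fun p : (G → ℝ) × (G → ℝ) => entFun p.1) :=
    continuous_entFun.comp continuous_fst
  have h3 : Continuous (fun p : (G → ℝ) × (G → ℝ) => entFun p.2) :=
    continuous_entFun.comp continuous_snd
  have e : (fun p : (G → ℝ) × (G → ℝ) => dLaw p.1 p.2) =
      fun p => entFun (subLaw p.1 p.2) - entFun p.1 / 2 - entFun p.2 / 2 := rfl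
  rw [e]
  exact (h1.sub (h2.div_const 2)).sub (h3.div_const 2)

/-- The `τ` functional is (jointly) continuous in `(μ₁, μ₂)`.
[cite: GowersEtAl2025, §2 (proof of Theorem 1.8)] -/
theorem continuous_tauLaw (η : ℝ) (ρ₁ ρ₂ : G → ℝ) :
    Continuous (fun p : (G → ℝ) × (G → ℝ) => tauLaw η ρ₁ ρ₂ p.1 p.2) := by
  have h0 := continuous_dLaw (G := G)
  have g1 : Continuous (fun p : (G → ℝ) × (G → ℝ) => ((ρ₁, p.1) : (G → ℝ) × (G → ℝ))) :=
    continuous_const.prodMk continuous_fst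
  have g2 : Continuous (fun p : (G → ℝ) × (G → ℝ) => ((ρ₂, p.2) : (G → ℝ) × (G → ℝ))) :=
    continuous_const.prodMk continuous_snd
  have h1 := h0.comp g1
  have h2 := h0.comp g2
  -- `dsimp` the compositions to the pointwise form before combining (this avoids an expensive
  -- definitional unfolding of `dLaw` by the unifier)
  dsimp only [Function.comp_def] at h1 h2
  have h := (h0.add (h1.const_mul η)).add (h2.const_mul η)
  dsimp only [tauLaw]
  exact h

/-- **Existence of `τ`-minimisers** (GGMT §2, proof of Theorem 1.8: "the usual topology on this
space is compact, and … `d` is continuous …, so the minimum exists"). [cite: GowersEtAl2025, §2 (proof of Theorem 1.8)] -/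
theorem isTauMin_exists [DecidableEq G] (η : ℝ) (ρ₁ ρ₂ : G → ℝ) :
    ∃ μ₁ μ₂ : G → ℝ, μ₁ ∈ stdSimplex ℝ G ∧ μ₂ ∈ stdSimplex ℝ G ∧ IsTauMin η ρ₁ ρ₂ μ₁ μ₂ := by
  have hK : IsCompact (stdSimplex ℝ G ×ˢ stdSimplex ℝ G) :=
    (isCompact_stdSimplex ℝ G).prod (isCompact_stdSimplex ℝ G)
  have hne : (stdSimplex ℝ G ×ˢ stdSimplex ℝ G).Nonempty :=
    ⟨(Pi.single (0 : G) 1, Pi.single (0 : G) 1), single_mem_stdSimplex ℝ (0 : G),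
      single_mem_stdSimplex ℝ (0 : G)⟩
  obtain ⟨p, hp, hmin⟩ := hK.exists_isMinOn hne (continuous_tauLaw η ρ₁ ρ₂).continuousOn
  rw [isMinOn_iff] at hmin
  refine ⟨p.1, p.2, hp.1, hp.2, fun ν₁ ν₂ h₁ h₂ => ?_⟩
  have h := hmin (ν₁, ν₂) (Set.mk_mem_prod h₁ h₂)
  dsimp only at h
  exact h

/-! ### The setting of GGMT §§5–7

Two laws `μ₁, μ₂` minimising `τ` (reference laws `ρ₁, ρ₂`, parameter `η`), realised together
with independent copies as four random variables `X₁, X₂, X₁', X₂'` (GGMT: `X₁, X₂, X̃₁, X̃₂`)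
on one finite weighted set `(s, P)`: laws `μ₁, μ₂, μ₁, μ₂`, and the independence of the
quadruple in the form of the three splittings `(X₁,X₂) ⊥ (X₁',X₂')`, `(X₁,X₂') ⊥ (X₂,X₁')`,
`(X₁,X₁') ⊥ (X₂,X₂')`. We write `k = d[μ₁ ; μ₂]`, `U = X₁ + X₂`, `V = X₁' + X₂`,
`W = X₁ + X₁'`, `S = X₁ + X₂ + X₁' + X₂'`, `I₁ = I[U : V | S]`, `I₂ = I[U : W | S]`. -/

section Estimates

variable [DecidableEq G] [Module (ZMod 2) G] {ι : Type*} {s : Finset ι} {P : ι → ℝ}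
  {X₁ X₂ X₁' X₂' : ι → G} {η : ℝ} {ρ₁ ρ₂ μ₁ μ₂ : G → ℝ}

/-- In the setting of §5: `H[X₁ + X₂'] = k + H[μ₁]/2 + H[μ₂]/2` for the independent pair
`(X₁, X₂')` with laws `μ₁, μ₂`. [cite: GowersEtAl2025, §5] -/
theorem ent_add_eq_of_laws {A B : ι → G} (h : IndepRV s P A B) (lA : prob s P A = μ₁)
    (lB : prob s P B = μ₂) :
    ent s P (fun ω => A ω + B ω) = dLaw μ₁ μ₂ + entFun μ₁ / 2 + entFun μ₂ / 2 := by
  have h1 := h.rdist_eq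
  rw [rdist_def, lA, lB, ent_eq_entFun s P A, ent_eq_entFun s P B, lA, lB] at h1
  linarith

/-- **GGMT §5, first estimate** ((5.1) and (5.10)): `I₁ ≤ 2 η k` and the entropy bound
`H[S] ≤ H[X₁]/2 + H[X₂]/2 + (2 + η) k - I₁`. [cite: GowersEtAl2025, §5 (5.1), (5.10)] -/
theorem first_estimate_aux (hP : ∀ ω ∈ s, 0 ≤ P ω) (hs : 0 < mass s P)
    (l₁ : prob s P X₁ = μ₁) (l₂ : prob s P X₂ = μ₂) (l₁' : prob s P X₁' = μ₁)
    (l₂' : prob s P X₂' = μ₂)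
    (iA : IndepRV s P (fun ω => (X₁ ω, X₂ ω)) (fun ω => (X₁' ω, X₂' ω)))
    (iB : IndepRV s P (fun ω => (X₁ ω, X₂' ω)) (fun ω => (X₂ ω, X₁' ω)))
    (hρ₁ : ρ₁ ∈ stdSimplex ℝ G) (hρ₂ : ρ₂ ∈ stdSimplex ℝ G) (hmin : IsTauMin η ρ₁ ρ₂ μ₁ μ₂)
    (hη : 0 ≤ η) :
    condMutualInfo s P (fun ω => X₁ ω + X₂ ω) (fun ω => X₁' ω + X₂ ω)
        (fun ω => X₁ ω + X₂ ω + X₁' ω + X₂' ω) ≤ 2 * η * dLaw μ₁ μ₂ ∧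
      ent s P (fun ω => X₁ ω + X₂ ω + X₁' ω + X₂' ω) ≤
        entFun μ₁ / 2 + entFun μ₂ / 2 + (2 + η) * dLaw μ₁ μ₂ -
          condMutualInfo s P (fun ω => X₁ ω + X₂ ω) (fun ω => X₁' ω + X₂ ω)
            (fun ω => X₁ ω + X₂ ω + X₁' ω + X₂' ω) := by
  -- reference spaces
  have hw₁ := stdSimplex_nonneg hρ₁
  have hw₂ := stdSimplex_nonneg hρ₂
  have hs₁ := mass_univ_pos_of_mem_stdSimplex hρ₁
  have hs₂ := mass_univ_pos_of_mem_stdSimplex hρ₂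
  -- independence facts
  have h₁ : IndepRV s P X₁ X₂' := iA.comp Prod.fst Prod.snd
  have h₂ : IndepRV s P X₂ X₁' := iA.comp Prod.snd Prod.fst
  have h₁₂ : IndepRV s P (fun ω => (X₁ ω, X₂ ω)) (fun ω => (X₂' ω, X₁' ω)) := iA.comp id Prod.swap
  have hAB : IndepRV s P (fun ω => X₁ ω + X₂' ω) (fun ω => X₂ ω + X₁' ω) :=
    iB.comp (fun p => p.1 + p.2) (fun p => p.1 + p.2)
  -- laws and entropies
  have eX₁ : ent s P X₁ = entFun μ₁ := by rw [ent_eq_entFun, l₁]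
  have eX₂ : ent s P X₂ = entFun μ₂ := by rw [ent_eq_entFun, l₂]
  have eX₁' : ent s P X₁' = entFun μ₁ := by rw [ent_eq_entFun, l₁']
  have eX₂' : ent s P X₂' = entFun μ₂ := by rw [ent_eq_entFun, l₂']
  have e12 : rdist s P X₁ s P X₂ = dLaw μ₁ μ₂ := by rw [rdist_def, l₁, l₂]
  have e21 : rdist s P X₂' s P X₁' = dLaw μ₁ μ₂ := by rw [rdist_def, l₂', l₁', dLaw_comm]
  have eE₁ : ent s P (fun ω => X₁ ω + X₂' ω) = dLaw μ₁ μ₂ + entFun μ₁ / 2 + entFun μ₂ / 2 :=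
    ent_add_eq_of_laws h₁ l₁ l₂'
  have eE₂ : ent s P (fun ω => X₂ ω + X₁' ω) = dLaw μ₁ μ₂ + entFun μ₁ / 2 + entFun μ₂ / 2 := by
    rw [ent_add_eq_of_laws h₂ l₂ l₁', dLaw_comm]; ring
  have r₁ : rdist univ ρ₁ id s P X₁ = dLaw ρ₁ μ₁ := by rw [rdist_univ_id hρ₁, l₁]
  have r₂ : rdist univ ρ₂ id s P X₂ = dLaw ρ₂ μ₂ := by rw [rdist_univ_id hρ₂, l₂]
  -- the fibring identity (5.2)
  have hfib := rdist_add_rdist_eq_fibring hP hs iB h₁₂ h₁ h₂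
  have hI : condMutualInfo s P (fun ω => X₁ ω + X₂ ω) (fun ω => X₂ ω + X₁' ω)
      (fun ω => X₁ ω + X₂ ω + X₂' ω + X₁' ω) =
      condMutualInfo s P (fun ω => X₁ ω + X₂ ω) (fun ω => X₁' ω + X₂ ω)
        (fun ω => X₁ ω + X₂ ω + X₁' ω + X₂' ω) :=
    condMutualInfo_congr (fun _ _ => rfl) (fun _ _ => add_comm _ _) fun _ _ => by abel
  rw [hI, e12, e21] at hfib
  -- minimality (3.9), (3.10)
  have m₁ := hmin.le_rdist hρ₁ hρ₂ (fun ω => X₁ ω + X₂' ω) (fun ω => X₂ ω + X₁' ω) hP hs hP hs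
  have m₂ := hmin.le_condRdist hρ₁ hρ₂ X₁ (fun ω => X₁ ω + X₂' ω) X₂ (fun ω => X₂ ω + X₁' ω)
    hP hs hP hs
  -- Lemma 5.2, four times
  have a₁ := rdist_add_sub_rdist_le (id : G → G) h₁ hw₁ hs₁ hP hs
  have a₂ := rdist_add_sub_rdist_le (id : G → G) h₂ hw₂ hs₂ hP hs
  have b₁ := condRdist'_add_sub_rdist_le (id : G → G) h₁ hw₁ hs₁ hP hs
  have b₂ := condRdist'_add_sub_rdist_le (id : G → G) h₂ hw₂ hs₂ hP hs
  rw [r₁] at a₁ b₁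
  rw [r₂] at a₂ b₂
  rw [eE₁, eX₁] at a₁
  rw [eE₂, eX₂] at a₂
  rw [eE₁, eX₂'] at b₁
  rw [eE₂, eX₁'] at b₂
  -- `d[X₁ + X₂' ; X₂ + X₁'] = H[S] - E₁/2 - E₂/2`
  have dS := hAB.rdist_eq
  have eS : ent s P (fun ω => X₁ ω + X₂' ω + (X₂ ω + X₁' ω)) =
      ent s P (fun ω => X₁ ω + X₂ ω + X₁' ω + X₂' ω) := ent_congr fun _ _ => by abel
  rw [eS, eE₁, eE₂] at dS
  -- bookkeeping with `η ≥ 0`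
  set T₁ := rdist univ ρ₁ id s P (fun ω => X₁ ω + X₂' ω) - dLaw ρ₁ μ₁ with hT₁
  set T₂ := rdist univ ρ₂ id s P (fun ω => X₂ ω + X₁' ω) - dLaw ρ₂ μ₂ with hT₂
  set T₃ := condRdist' univ ρ₁ id s P X₁ (fun ω => X₁ ω + X₂' ω) - dLaw ρ₁ μ₁ with hT₃
  set T₄ := condRdist' univ ρ₂ id s P X₂ (fun ω => X₂ ω + X₁' ω) - dLaw ρ₂ μ₂ with hT₄
  have hTsum : T₁ + T₂ + T₃ + T₄ ≤ 2 * dLaw μ₁ μ₂ := by linarith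
  have hT34 : T₃ + T₄ ≤ dLaw μ₁ μ₂ := by linarith
  have hη1 := mul_le_mul_of_nonneg_left hTsum hη
  have hη2 := mul_le_mul_of_nonneg_left hT34 hη
  constructor
  · linarith
  · linarith

/-- **GGMT §5, (5.1)**: `I₁ = I[X₁ + X₂ : X₁' + X₂ | S] ≤ 2 η k`. [cite: GowersEtAl2025, §5 (5.1)] -/
theorem first_estimate (hP : ∀ ω ∈ s, 0 ≤ P ω) (hs : 0 < mass s P)
    (l₁ : prob s P X₁ = μ₁) (l₂ : prob s P X₂ = μ₂) (l₁' : prob s P X₁' = μ₁)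
    (l₂' : prob s P X₂' = μ₂)
    (iA : IndepRV s P (fun ω => (X₁ ω, X₂ ω)) (fun ω => (X₁' ω, X₂' ω)))
    (iB : IndepRV s P (fun ω => (X₁ ω, X₂' ω)) (fun ω => (X₂ ω, X₁' ω)))
    (hρ₁ : ρ₁ ∈ stdSimplex ℝ G) (hρ₂ : ρ₂ ∈ stdSimplex ℝ G) (hmin : IsTauMin η ρ₁ ρ₂ μ₁ μ₂)
    (hη : 0 ≤ η) :
    condMutualInfo s P (fun ω => X₁ ω + X₂ ω) (fun ω => X₁' ω + X₂ ω)
        (fun ω => X₁ ω + X₂ ω + X₁' ω + X₂' ω) ≤ 2 * η * dLaw μ₁ μ₂ :=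
  (first_estimate_aux hP hs l₁ l₂ l₁' l₂' iA iB hρ₁ hρ₂ hmin hη).1

/-- **GGMT §5, (5.10)**: `H[S] ≤ H[X₁]/2 + H[X₂]/2 + (2 + η) k - I₁`.
[cite: GowersEtAl2025, §5 (5.10)] -/
theorem ent_sum_four_le (hP : ∀ ω ∈ s, 0 ≤ P ω) (hs : 0 < mass s P)
    (l₁ : prob s P X₁ = μ₁) (l₂ : prob s P X₂ = μ₂) (l₁' : prob s P X₁' = μ₁)
    (l₂' : prob s P X₂' = μ₂)
    (iA : IndepRV s P (fun ω => (X₁ ω, X₂ ω)) (fun ω => (X₁' ω, X₂' ω)))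
    (iB : IndepRV s P (fun ω => (X₁ ω, X₂' ω)) (fun ω => (X₂ ω, X₁' ω)))
    (hρ₁ : ρ₁ ∈ stdSimplex ℝ G) (hρ₂ : ρ₂ ∈ stdSimplex ℝ G) (hmin : IsTauMin η ρ₁ ρ₂ μ₁ μ₂)
    (hη : 0 ≤ η) :
    ent s P (fun ω => X₁ ω + X₂ ω + X₁' ω + X₂' ω) ≤
      entFun μ₁ / 2 + entFun μ₂ / 2 + (2 + η) * dLaw μ₁ μ₂ -
        condMutualInfo s P (fun ω => X₁ ω + X₂ ω) (fun ω => X₁' ω + X₂ ω)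
          (fun ω => X₁ ω + X₂ ω + X₁' ω + X₂' ω) :=
  (first_estimate_aux hP hs l₁ l₂ l₁' l₂' iA iB hρ₁ hρ₂ hmin hη).2

/-- **GGMT §6, second estimate** ((6.1)): `I₂ = I[X₁ + X₂ : X₁ + X₁' | S] ≤ 2 η k +
2 η (2 η k - I₁) / (1 - η)`. [cite: GowersEtAl2025, §6 (6.1)] -/
theorem second_estimate (hP : ∀ ω ∈ s, 0 ≤ P ω) (hs : 0 < mass s P)
    (l₁ : prob s P X₁ = μ₁) (l₂ : prob s P X₂ = μ₂) (l₁' : prob s P X₁' = μ₁)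
    (l₂' : prob s P X₂' = μ₂)
    (iA : IndepRV s P (fun ω => (X₁ ω, X₂ ω)) (fun ω => (X₁' ω, X₂' ω)))
    (iB : IndepRV s P (fun ω => (X₁ ω, X₂' ω)) (fun ω => (X₂ ω, X₁' ω)))
    (iC : IndepRV s P (fun ω => (X₁ ω, X₁' ω)) (fun ω => (X₂ ω, X₂' ω)))
    (hρ₁ : ρ₁ ∈ stdSimplex ℝ G) (hρ₂ : ρ₂ ∈ stdSimplex ℝ G) (hmin : IsTauMin η ρ₁ ρ₂ μ₁ μ₂)
    (hη : 0 ≤ η) (hη1 : η < 1) :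
    condMutualInfo s P (fun ω => X₁ ω + X₂ ω) (fun ω => X₁ ω + X₁' ω)
        (fun ω => X₁ ω + X₂ ω + X₁' ω + X₂' ω) ≤
      2 * η * dLaw μ₁ μ₂ + 2 * η * (2 * η * dLaw μ₁ μ₂ -
        condMutualInfo s P (fun ω => X₁ ω + X₂ ω) (fun ω => X₁' ω + X₂ ω)
          (fun ω => X₁ ω + X₂ ω + X₁' ω + X₂' ω)) / (1 - η) := by
  -- reference spaces
  have hw₁ := stdSimplex_nonneg hρ₁
  have hw₂ := stdSimplex_nonneg hρ₂
  have hs₁ := mass_univ_pos_of_mem_stdSimplex hρ₁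
  have hs₂ := mass_univ_pos_of_mem_stdSimplex hρ₂
  -- independence facts
  have h₁ : IndepRV s P X₁ X₁' := iA.comp Prod.fst Prod.fst
  have h₂ : IndepRV s P X₂ X₂' := iA.comp Prod.snd Prod.snd
  have hCD : IndepRV s P (fun ω => X₁ ω + X₁' ω) (fun ω => X₂ ω + X₂' ω) :=
    iC.comp (fun p => p.1 + p.2) (fun p => p.1 + p.2)
  -- laws and entropies
  have eX₁ : ent s P X₁ = entFun μ₁ := by rw [ent_eq_entFun, l₁]
  have eX₂ : ent s P X₂ = entFun μ₂ := by rw [ent_eq_entFun, l₂]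
  have eX₁' : ent s P X₁' = entFun μ₁ := by rw [ent_eq_entFun, l₁']
  have eX₂' : ent s P X₂' = entFun μ₂ := by rw [ent_eq_entFun, l₂']
  have e12 : rdist s P X₁ s P X₂ = dLaw μ₁ μ₂ := by rw [rdist_def, l₁, l₂]
  have e12' : rdist s P X₁' s P X₂' = dLaw μ₁ μ₂ := by rw [rdist_def, l₁', l₂']
  have eE₁ : ent s P (fun ω => X₁ ω + X₁' ω) = dLaw μ₁ μ₁ + entFun μ₁ / 2 + entFun μ₁ / 2 :=
    ent_add_eq_of_laws h₁ l₁ l₁'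
  have eE₂ : ent s P (fun ω => X₂ ω + X₂' ω) = dLaw μ₂ μ₂ + entFun μ₂ / 2 + entFun μ₂ / 2 :=
    ent_add_eq_of_laws h₂ l₂ l₂'
  have r₁ : rdist univ ρ₁ id s P X₁ = dLaw ρ₁ μ₁ := by rw [rdist_univ_id hρ₁, l₁]
  have r₂ : rdist univ ρ₂ id s P X₂ = dLaw ρ₂ μ₂ := by rw [rdist_univ_id hρ₂, l₂]
  -- the fibring identity, with `I[U : W' | S]` converted into `I[U : W | S]`
  have hfib := rdist_add_rdist_eq_fibring hP hs iC iA h₁ h₂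
  have hI : condMutualInfo s P (fun ω => X₁ ω + X₂ ω) (fun ω => X₂ ω + X₂' ω)
      (fun ω => X₁ ω + X₂ ω + X₁' ω + X₂' ω) =
      condMutualInfo s P (fun ω => X₁ ω + X₂ ω) (fun ω => X₁ ω + X₁' ω)
        (fun ω => X₁ ω + X₂ ω + X₁' ω + X₂' ω) := by
    rw [condMutualInfo_eq_condEnt, condMutualInfo_eq_condEnt]
    have e1 : condEnt s P (fun ω => X₂ ω + X₂' ω) (fun ω => X₁ ω + X₂ ω + X₁' ω + X₂' ω) =
        condEnt s P (fun ω => X₁ ω + X₁' ω) (fun ω => X₁ ω + X₂ ω + X₁' ω + X₂' ω) := by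
      refine condEnt_eq_of_determines_left hP fun i _ j _ hS => ?_
      constructor
      · intro h; linear_combination (norm := abel) hS - h
      · intro h; linear_combination (norm := abel) hS - h
    have e2 : condEnt s P (fun ω => (X₁ ω + X₂ ω, X₂ ω + X₂' ω))
        (fun ω => X₁ ω + X₂ ω + X₁' ω + X₂' ω) =
        condEnt s P (fun ω => (X₁ ω + X₂ ω, X₁ ω + X₁' ω))
          (fun ω => X₁ ω + X₂ ω + X₁' ω + X₂' ω) := by
      refine condEnt_eq_of_determines_left hP fun i _ j _ hS => ?_
      simp only [Prod.mk.injEq]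
      constructor
      · rintro ⟨ha, hb⟩; exact ⟨ha, by linear_combination (norm := abel) hS - hb⟩
      · rintro ⟨ha, hb⟩; exact ⟨ha, by linear_combination (norm := abel) hS - hb⟩
    rw [e1, e2]
  rw [hI, e12, e12'] at hfib
  -- minimality (3.9), (3.10)
  have m₁ := hmin.le_rdist hρ₁ hρ₂ (fun ω => X₁ ω + X₁' ω) (fun ω => X₂ ω + X₂' ω) hP hs hP hs
  have m₂ := hmin.le_condRdist hρ₁ hρ₂ X₁ (fun ω => X₁ ω + X₁' ω) X₂ (fun ω => X₂ ω + X₂' ω)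
    hP hs hP hs
  -- Lemma 5.2, four times ((6.3)–(6.6))
  have a₁ := rdist_add_sub_rdist_le (id : G → G) h₁ hw₁ hs₁ hP hs
  have a₂ := rdist_add_sub_rdist_le (id : G → G) h₂ hw₂ hs₂ hP hs
  have b₁ := condRdist'_add_sub_rdist_le (id : G → G) h₁ hw₁ hs₁ hP hs
  have b₂ := condRdist'_add_sub_rdist_le (id : G → G) h₂ hw₂ hs₂ hP hs
  rw [r₁] at a₁ b₁
  rw [r₂] at a₂ b₂
  rw [eE₁, eX₁] at a₁
  rw [eE₂, eX₂] at a₂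
  rw [eE₁, eX₁'] at b₁
  rw [eE₂, eX₂'] at b₂
  -- `d[X₁ + X₁' ; X₂ + X₂'] = H[S] - E₁/2 - E₂/2`
  have dS := hCD.rdist_eq
  have eS : ent s P (fun ω => X₁ ω + X₁' ω + (X₂ ω + X₂' ω)) =
      ent s P (fun ω => X₁ ω + X₂ ω + X₁' ω + X₂' ω) := ent_congr fun _ _ => by abel
  rw [eS, eE₁, eE₂] at dS
  -- the entropy bound (5.10) from the first estimate
  have hS := ent_sum_four_le hP hs l₁ l₂ l₁' l₂' iA iB hρ₁ hρ₂ hmin hη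
  -- bookkeeping
  set k := dLaw μ₁ μ₂ with hk
  set D := dLaw μ₁ μ₁ + dLaw μ₂ μ₂ with hD
  set I₁ := condMutualInfo s P (fun ω => X₁ ω + X₂ ω) (fun ω => X₁' ω + X₂ ω)
    (fun ω => X₁ ω + X₂ ω + X₁' ω + X₂' ω) with hI₁
  set I₂ := condMutualInfo s P (fun ω => X₁ ω + X₂ ω) (fun ω => X₁ ω + X₁' ω)
    (fun ω => X₁ ω + X₂ ω + X₁' ω + X₂' ω) with hI₂
  set T₁ := rdist univ ρ₁ id s P (fun ω => X₁ ω + X₁' ω) - dLaw ρ₁ μ₁ with hT₁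
  set T₂ := rdist univ ρ₂ id s P (fun ω => X₂ ω + X₂' ω) - dLaw ρ₂ μ₂ with hT₂
  set T₃ := condRdist' univ ρ₁ id s P X₁ (fun ω => X₁ ω + X₁' ω) - dLaw ρ₁ μ₁ with hT₃
  set T₄ := condRdist' univ ρ₂ id s P X₂ (fun ω => X₂ ω + X₂' ω) - dLaw ρ₂ μ₂ with hT₄
  have hT12 : T₁ + T₂ ≤ D / 2 := by linarith
  have hTall : T₁ + T₂ + T₃ + T₄ ≤ D := by linarith
  have hη1' := mul_le_mul_of_nonneg_left hT12 hη
  have hη2' := mul_le_mul_of_nonneg_left hTall hη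
  -- (6.7): `I₂ ≤ η D`
  have h67 : I₂ ≤ η * D := by linarith
  -- (6.9): `D (1 - η) ≤ 2 ((1 + η) k - I₁)`
  have h69 : D * (1 - η) ≤ 2 * ((1 + η) * k - I₁) := by linarith
  -- conclusion
  have hpos : 0 < 1 - η := by linarith
  have key : I₂ * (1 - η) ≤ 2 * η * ((1 + η) * k - I₁) := by
    have h1 := mul_le_mul_of_nonneg_left h69 hη
    have h2 := mul_le_mul_of_nonneg_right h67 hpos.le
    linarith
  set c := (1 - η)⁻¹ with hcdef
  have hc : (1 - η) * c = 1 := mul_inv_cancel₀ hpos.ne'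
  have hc0 : 0 ≤ c := inv_nonneg.2 hpos.le
  rw [div_eq_mul_inv, ← hcdef]
  calc I₂ = I₂ * (1 - η) * c := by rw [mul_assoc, hc, mul_one]
    _ ≤ 2 * η * ((1 + η) * k - I₁) * c := mul_le_mul_of_nonneg_right key hc0
    _ = 2 * η * k + 2 * η * (2 * η * k - I₁) * c := by linear_combination (2 * η * k) * hc

end Estimates

end EntropicRuzsa

end Literature.Combinatorics.Additive

end
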